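import Literature.Probability.Percolation.MarkedLoopSiteLaw
import Literature.Probability.Percolation.MarkedLoopLinkPatternLaw
import Literature.Probability.Percolation.MarkedLoopBoundarySupport
import HarnessLib

/-!
# The site law for `N_j(z)` and `H_j(z)` (every number of marks)

Topic `Literature/Probability/Percolation`; a rider on `MarkedLoopSiteLaw.lean` (the loop-side SITE LAW, `site_law_classCount`) and
`MarkedLoopLinkPatternLaw.lean` (`classCountK`, `HobsK`): the class counts `N_j(z)` and the link probabilities `H_j(z) = N_j(z) / 2^{#G}`
of Khristoforov–Smirnov's link pattern AGREE at the two `H_G` mid-edges around a tip (`TipFace`), in particular at two consecutive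
boundary darts with a common tail around a non-marked boundary hexagon (`exists_tipFace_of_apex_not_mem`); and the corner
hypothesis discharged: two consecutive darts of the SAME stretch never turn around a corner face (`leftFace_not_mem_corners_of_mem_stretch`,
via `dart_eq_of_corner_side` and the gap indices of `MarkedLoopBoundarySupport.lean`), so ★ `classCountK_site_law_stretch` needs only
`(u, v), (u, w) ∈ A_a` — the every-`k`, loop-side form of the tree's five-point `Bdry.edgeFun_step`; and ★★ `classCountK_site_law_run`
(`k ≥ 3`): ANY two darts of one stretch with the same tail carry the same `N_j` at their dual edges — the run of a boundary hexagon
inside a stretch is contiguous (`fst_iter_eq_of_between`, from `TriMarkedDomain.tail_not_interleaved` exactly as the tree's five-point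
`Bdry.fst_iter_eq_of_between`), so the step law chains.

## References
* M. Khristoforov, S. Smirnov, *Percolation and O(1) loop model*, arXiv:2111.15612 (2021), §1.2 (arXiv v1 p. 2), §2 Definition 3 (p. 4),
  Remark 6 (p. 5).
* B. Bollobás, O. Riordan, *Percolation*, CUP (2006), Ch. 7 §7.2.2 (pp. 191–195).
-/

open Finset

namespace Literature.Probability.Percolation.MarkedLoops

open Literature.Probability.Percolation Literature.Probability.LatticeModels
open Literature.Probability.Percolation.FivePoint (side side_injective Inc inc_side inc_mk_iff)
open Literature.Probability.Percolation.FivePoint.N5 (side_oppFace_oppIdx)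
open TriMarkedDomain

variable {nm : ℕ} {D : TriMarkedDomain nm}

/-- ★ **the site law for `N_j`**: `classCountK D v i j = classCountK D v' i' j` around a tip.
[cite: KhristoforovSmirnov2021, §1.2 (arXiv v1 p. 2), §2 Definition 3 (p. 4) and Remark 6 (p. 5)] -/
theorem classCountK_site_law {v v' : HexVertex} {i i' : Fin 3} (T : TipFace D v i v' i') (j : Fin nm) :
    classCountK D v i j = classCountK D v' i' j := by
  unfold classCountK
  exact site_law_classCount T j

/-- ★ **the site law for `H_j = N_j / 2^{#G}`**. [cite: KhristoforovSmirnov2021, §1.2 (arXiv v1 p. 2), §2 Definition 3 (p. 4) and Remark 6 (p. 5)] -/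
theorem hobsK_site_law {v v' : HexVertex} {i i' : Fin 3} (T : TipFace D v i v' i') (j : Fin nm) :
    HobsK D v i j = HobsK D v' i' j := by
  unfold HobsK
  rw [classCountK_site_law T j]

/-- ★ **the site law for two consecutive boundary darts** `(u, v)`, `(u, w)` (`w = triLeftApex u v ∉ G`, the turning face not a corner):
`N_j` read at the face right of `u → v` across `uv` equals `N_j` read at the face left of `u → w` across `uw`.
[cite: BollobasRiordan2006, Ch. 7 §7.2.2 pp. 191–195] -/
theorem classCountK_site_law_darts {u v : Site 2} (hu : u ∈ D.verts) (hv : v ∉ D.verts) (hadj : triGraph.Adj u v)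
    (hw : triLeftApex u v ∉ D.verts) (hF : leftFace u v ∉ corners D) (j : Fin nm) :
    ∃ i i' : Fin 3, side (leftFace v u) i = s(u, v) ∧ side (leftFace u (triLeftApex u v)) i' = s(u, triLeftApex u v) ∧
      classCountK D (leftFace v u) i j = classCountK D (leftFace u (triLeftApex u v)) i' j := by
  obtain ⟨i, i', hi, hi', -, T⟩ := exists_tipFace_of_apex_not_mem hu hv hadj hw hF
  exact ⟨i, i', hi, hi', classCountK_site_law T j⟩

/-- ★ **two consecutive darts of one stretch do not turn around a corner face**: if `(u, v)` and `(u, w)` (`w = triLeftApex u v`) both lie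
on the stretch `A_a` of a domain with at least two marks, the turning face `leftFace u v` is not a corner face (a corner face `y_m` is
turned around exactly by `predDart m ∈ A_{m-1}` and `markDart m ∈ A_m`). [cite: BollobasRiordan2006, Ch. 7 §7.2.2 pp. 191–195] -/
theorem leftFace_not_mem_corners_of_mem_stretch (h2 : 2 ≤ nm) {a : Fin nm} {u v : Site 2} (hd : (u, v) ∈ D.stretch a)
    (hd' : (u, triLeftApex u v) ∈ D.stretch a) : leftFace u v ∉ corners D := by
  classical
  intro hc
  obtain ⟨m, hm⟩ := (mem_corners D).1 hc
  have hF : IsCornerFace D m (leftFace u v) := by rw [hm]; exact yc_spec D m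
  obtain ⟨-, -, -, -, hbd⟩ := pos_facts_of_mem_stretch hd
  obtain ⟨-, -, -, -, hbd'⟩ := pos_facts_of_mem_stretch hd'
  obtain ⟨hu, hv, hadj⟩ := mem_triBdryDarts.1 hbd
  obtain ⟨-, hw, hadj'⟩ := mem_triBdryDarts.1 hbd'
  -- both bonds are sides of the turning face
  have huF : u ∈ hexFaceVertices (leftFace u v) := by rw [hexFaceVertices_leftFace hadj]; simp
  have hvF : v ∈ hexFaceVertices (leftFace u v) := by rw [hexFaceVertices_leftFace hadj]; simp
  have hwF : triLeftApex u v ∈ hexFaceVertices (leftFace u v) := by rw [hexFaceVertices_leftFace hadj]; simp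
  obtain ⟨j, hj⟩ := exists_side_eq_of_inc D (mem_hBonds D hadj (Or.inl hu)) (inc_mk_iff.2 ⟨huF, hvF⟩ : Inc (leftFace u v) s(u, v))
  obtain ⟨j', hj'⟩ := exists_side_eq_of_inc D (mem_hBonds D hadj' (Or.inl hu))
    (inc_mk_iff.2 ⟨huF, hwF⟩ : Inc (leftFace u v) s(u, triLeftApex u v))
  have h1 := dart_eq_of_corner_side hF hj.symm hu hv
  have h1' := dart_eq_of_corner_side hF hj'.symm hu hw
  have hne : (u, v) ≠ (u, triLeftApex u v) := fun e => (triLeftApex_ne hadj).2 (Prod.ext_iff.1 e).2.symm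
  -- the two darts are `predDart m` and `markDart m`, on the stretches of gap index 0 and k - 1 from `a`
  have key : predDart D m ∈ D.stretch a ∧ D.markDart m ∈ D.stretch a := by
    rcases h1 with e | e <;> rcases h1' with e' | e'
    · exact absurd (e.trans e'.symm) hne
    · exact ⟨e ▸ hd, e' ▸ hd'⟩
    · exact ⟨e' ▸ hd', e ▸ hd⟩
    · exact absurd (e.trans e'.symm) hne
  have g0 := gapIdx_of_predDart_mem_stretch key.1
  have g1 := gapIdx_of_markDart_mem_stretch key.2
  omega

/-- ★★ **THE SITE LAW ALONG A STRETCH (every number of marks `k ≥ 2`)**: for two consecutive boundary darts `(u, v)`, `(u, w)` of the same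
stretch `A_a` (`w = triLeftApex u v`; the boundary walk turns around the hexagon `H_u`), the class counts `N_j` of the link pattern at the
dual `H_G`-edges `uv`, `uw` agree for every corner `j` — the loop-side form of the tree's five-point step `Bdry.edgeFun_step`.
[cite: KhristoforovSmirnov2021, §2 Remark 6 (arXiv v1 p. 5, asserted at k = 3); BollobasRiordan2006, Ch. 7 §7.2.2 pp. 191–195] -/
theorem classCountK_site_law_stretch (h2 : 2 ≤ nm) {a : Fin nm} {u v : Site 2} (hd : (u, v) ∈ D.stretch a)
    (hd' : (u, triLeftApex u v) ∈ D.stretch a) (j : Fin nm) :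
    ∃ i i' : Fin 3, side (leftFace v u) i = s(u, v) ∧ side (leftFace u (triLeftApex u v)) i' = s(u, triLeftApex u v) ∧
      classCountK D (leftFace v u) i j = classCountK D (leftFace u (triLeftApex u v)) i' j := by
  obtain ⟨-, -, -, -, hbd⟩ := pos_facts_of_mem_stretch hd
  obtain ⟨-, -, -, -, hbd'⟩ := pos_facts_of_mem_stretch hd'
  obtain ⟨hu, hv, hadj⟩ := mem_triBdryDarts.1 hbd
  obtain ⟨-, hw, -⟩ := mem_triBdryDarts.1 hbd'
  exact classCountK_site_law_darts hu hv hadj hw (leftFace_not_mem_corners_of_mem_stretch h2 hd hd') j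

section Run

/-! ## The run of a boundary hexagon inside a stretch (every `k ≥ 3`) — port of `FivePointBoundarySite.lean` §1–§2 -/

/-- with at least three marks there is a mark other than `i` whose site is not `u` (the marked sites are distinct).
[cite: BollobasRiordan2006, Ch. 7 §7.2.2 pp. 191–195] -/
theorem exists_mark_ne_of_ne (h3 : 3 ≤ nm) (i : Fin nm) (u : Site 2) : ∃ i' : Fin nm, i' ≠ i ∧ D.markSite i' ≠ u := by
  classical
  by_contra h
  push Not at h
  have hcard : 1 < #((Finset.univ : Finset (Fin nm)).erase i) := by
    rw [Finset.card_erase_of_mem (Finset.mem_univ i), Finset.card_univ, Fintype.card_fin]; omega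
  obtain ⟨a, ha, b, hb, hab⟩ := Finset.one_lt_card.1 hcard
  have ha' := h a (Finset.mem_erase.1 ha).1
  have hb' := h b (Finset.mem_erase.1 hb).1
  exact hab (D.mark_injective (ha'.trans hb'.symm))

/-- **the run of a boundary hexagon inside a stretch is contiguous** (`k ≥ 3`): if the darts at positions `n ≤ n'` of the stretch `A_i`
have the same tail `u`, so does every dart in between (`tail_not_interleaved`, the separating fourth position being the marked dart of a
mark `i' ≠ i` not at `u`). [cite: BollobasRiordan2006, Ch. 7 §7.2.2 p. 192 («we do not visit the same vertex of ∂⁻(G) more than once») and pp. 191–195] -/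
theorem fst_iter_eq_of_between (h3 : 3 ≤ nm) {i : Fin nm} {n n' : ℕ} (hn : D.pos i ≤ n) (hnn' : n ≤ n') (hn' : n' < D.nextPos i)
    {u : Site 2} (hu : (triBdryIter D.verts D.base n).1 = u) (hu' : (triBdryIter D.verts D.base n').1 = u) {j : ℕ} (hnj : n ≤ j)
    (hjn' : j ≤ n') : (triBdryIter D.verts D.base j).1 = u := by
  rcases eq_or_lt_of_le hnj with rfl | hnj
  · exact hu
  rcases eq_or_lt_of_le hjn' with rfl | hjn'
  · exact hu'
  by_contra hj
  have hN : D.nextPos i ≤ #(triBdryDarts D.verts) := D.nextPos_le_bdryLen i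
  obtain ⟨i', hi'i, hi'u⟩ := exists_mark_ne_of_ne (D := D) h3 i u
  have hmark : (triBdryIter D.verts D.base (D.pos i')).1 ≠ u := hi'u
  rcases lt_or_gt_of_ne hi'i with hlt' | hgt'
  · -- the mark `i'` comes before the stretch: read the cycle from position `n`
    have hlt : D.pos i' < D.pos i := D.pos_strictMono hlt'
    have hb : triBdryIter D.verts D.base n ∈ triBdryDarts D.verts := triBdryIter_mem D.base_mem n
    have hshift : ∀ m, triBdryIter D.verts (triBdryIter D.verts D.base n) m = triBdryIter D.verts D.base (n + m) := fun m =>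
      (triBdryIter_add D.verts D.base n m).symm
    have h4 : (triBdryIter D.verts (triBdryIter D.verts D.base n) (D.pos i' + #(triBdryDarts D.verts) - n)).1 ≠ u := by
      rw [hshift, show n + (D.pos i' + #(triBdryDarts D.verts) - n) = D.pos i' + #(triBdryDarts D.verts) by omega,
        D.isTriDisc.iter_add_card]
      exact hmark
    rcases D.tail_not_interleaved hb (u := u) (n₁ := 0) (n₂ := j - n) (n₃ := n' - n)
        (n₄ := D.pos i' + #(triBdryDarts D.verts) - n) (by omega) (by omega) (by omega) (by omega)
        (by rw [hshift, Nat.add_zero]; exact hu) (by rw [hshift, show n + (n' - n) = n' by omega]; exact hu') with h | h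
    · rw [hshift, show n + (j - n) = j by omega] at h
      exact hj h
    · exact h4 h
  · -- the mark `i'` comes after the stretch: read the cycle from the base
    have hlt2 : n' < D.pos i' := lt_pos_of_lt hn' (Fin.lt_def.1 hgt')
    rcases D.tail_not_interleaved D.base_mem (u := u) hnj hjn' hlt2 (D.pos_lt i') hu hu' with h | h
    · exact hj h
    · exact hmark h

/-- Auxiliary: the face across the side `uv` of `x` is the other touching face incident to `uv`. [cite: KhristoforovSmirnov2021, §1.2 (arXiv v1 p. 2)] -/
private theorem oppFace_eq_of_inc_run {x G' : HexVertex} {j : Fin 3} {u v : Site 2} (hu : u ∈ D.verts) (hadj : triGraph.Adj u v)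
    (hx : side x j = s(u, v)) (hG' : G' ∈ triFacesTouching D.verts) (hinc : Inc G' s(u, v)) (hne : G' ≠ x) : oppFace x j = G' := by
  have hb : s(u, v) ∈ hBonds D := mem_hBonds D hadj (Or.inl hu)
  have hxt : x ∈ triFacesTouching D.verts := mem_touching_of_side_mem D (j := j) (by rw [hx]; exact hb)
  have hot : oppFace x j ∈ triFacesTouching D.verts :=
    mem_touching_of_side_mem D (j := oppIdx x j) (by rw [side_oppFace_oppIdx, hx]; exact hb)
  have ix : Inc x s(u, v) := by rw [← hx]; exact inc_side x j
  have io : Inc (oppFace x j) s(u, v) := by rw [← hx, ← side_oppFace_oppIdx x j]; exact inc_side _ _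
  rcases eq_or_eq_of_inc_three D hb hxt hot hG' ix io hinc (hexGraph_adj_oppFace x j).ne with e | e
  · exact absurd e hne
  · exact e.symm

/-- **the two readings of one `H_G`-edge**: `N_j` read at `leftFace u w` across `uw` equals `N_j` read at `leftFace w u` across `uw`
(`classCountK_oppFace_oppIdx`). [cite: KhristoforovSmirnov2021, §1.2 (arXiv v1 p. 2)] -/
theorem classCountK_leftFace_swap {u w : Site 2} (hu : u ∈ D.verts) (hadj : triGraph.Adj u w) {i₂ i₃ : Fin 3}
    (h₂ : side (leftFace u w) i₂ = s(u, w)) (h₃ : side (leftFace w u) i₃ = s(u, w)) (j : Fin nm) :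
    classCountK D (leftFace u w) i₂ j = classCountK D (leftFace w u) i₃ j := by
  have hb : s(u, w) ∈ hBonds D := mem_hBonds D hadj (Or.inl hu)
  have hx't : leftFace w u ∈ triFacesTouching D.verts := mem_touching_of_side_mem D (j := i₃) (by rw [h₃]; exact hb)
  have hinc : Inc (leftFace w u) s(u, w) := by rw [← h₃]; exact inc_side _ _
  have hne : leftFace w u ≠ leftFace u w := (leftFace_ne_leftFace_symm hadj).symm
  have hopp : oppFace (leftFace u w) i₂ = leftFace w u := oppFace_eq_of_inc_run hu hadj h₂ hx't hinc hne
  have hidx : oppIdx (leftFace u w) i₂ = i₃ := by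
    apply side_injective (leftFace w u)
    rw [h₃]
    have := side_oppFace_oppIdx (leftFace u w) i₂
    rw [hopp] at this
    rw [this, h₂]
  rw [← classCountK_oppFace_oppIdx D (leftFace u w) i₂ j, hopp, hidx]

/-- ★★ **THE SITE LAW ALONG A RUN (every number of marks `k ≥ 3`)**: two darts at positions `n ≤ n'` of the same stretch `A_a` with the
same tail carry the same class count `N_j` at their dual `H_G`-edges (read at the face right of the dart, at any side index presenting
the bond) — the loop-side, every-`k` form of the tree's five-point `Bdry.boundary_site_law`.
[cite: KhristoforovSmirnov2021, §2 Remark 6 (arXiv v1 p. 5, asserted at k = 3); BollobasRiordan2006, Ch. 7 §7.2.2 pp. 191–195] -/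
theorem classCountK_site_law_run (h3 : 3 ≤ nm) {a : Fin nm} {n n' : ℕ} (hn : D.pos a ≤ n) (hnn' : n ≤ n') (hn' : n' < D.nextPos a)
    (hfst : (triBdryIter D.verts D.base n').1 = (triBdryIter D.verts D.base n).1) (j : Fin nm) {i i' : Fin 3}
    (hi : side (leftFace (triBdryIter D.verts D.base n).2 (triBdryIter D.verts D.base n).1) i =
      s((triBdryIter D.verts D.base n).1, (triBdryIter D.verts D.base n).2))
    (hi' : side (leftFace (triBdryIter D.verts D.base n').2 (triBdryIter D.verts D.base n').1) i' =
      s((triBdryIter D.verts D.base n').1, (triBdryIter D.verts D.base n').2)) :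
    classCountK D (leftFace (triBdryIter D.verts D.base n).2 (triBdryIter D.verts D.base n).1) i j =
      classCountK D (leftFace (triBdryIter D.verts D.base n').2 (triBdryIter D.verts D.base n').1) i' j := by
  have h2 : 2 ≤ nm := by omega
  have hrun : ∀ m, n ≤ m → m ≤ n' → (triBdryIter D.verts D.base m).1 = (triBdryIter D.verts D.base n).1 := fun m hm1 hm2 =>
    fst_iter_eq_of_between h3 hn hnn' hn' rfl hfst hm1 hm2
  suffices H : ∀ m, n + m ≤ n' → ∀ i₁ : Fin 3,
      side (leftFace (triBdryIter D.verts D.base (n + m)).2 (triBdryIter D.verts D.base (n + m)).1) i₁ =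
        s((triBdryIter D.verts D.base (n + m)).1, (triBdryIter D.verts D.base (n + m)).2) →
      classCountK D (leftFace (triBdryIter D.verts D.base n).2 (triBdryIter D.verts D.base n).1) i j =
        classCountK D (leftFace (triBdryIter D.verts D.base (n + m)).2 (triBdryIter D.verts D.base (n + m)).1) i₁ j by
    have := H (n' - n) (by omega) i' (by rw [show n + (n' - n) = n' by omega]; exact hi')
    rw [show n + (n' - n) = n' by omega] at this
    exact this
  intro m
  induction m with
  | zero =>
    intro _ i₁ hi₁
    rw [Nat.add_zero] at hi₁ ⊢
    rw [side_injective _ (hi₁.trans hi.symm)]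
  | succ m ih =>
    intro hm i₁ hi₁
    rw [show n + (m + 1) = n + m + 1 from by omega] at hm hi₁ ⊢
    -- the darts `d = (u, v)` at `n + m` and `(u, w) = triBdrySucc d` at `n + m + 1`, `w = triLeftApex u v ∉ G`
    set d := triBdryIter D.verts D.base (n + m) with hd
    have hdm : d ∈ triBdryDarts D.verts := triBdryIter_mem D.base_mem _
    obtain ⟨hdG, -, hadj⟩ := mem_triBdryDarts.1 hdm
    have htail : d.1 = (triBdryIter D.verts D.base n).1 := hrun (n + m) (by omega) (by omega)
    have htail' : (triBdryIter D.verts D.base (n + m + 1)).1 = (triBdryIter D.verts D.base n).1 :=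
      hrun (n + m + 1) (by omega) (by omega)
    have hsucc : triBdryIter D.verts D.base (n + m + 1) = triBdrySucc D.verts d := triBdryIter_succ _ _ _
    have hout : triLeftApex d.1 d.2 ∉ D.verts := by
      intro h
      have e : (triBdryIter D.verts D.base (n + m + 1)).1 = triLeftApex d.1 d.2 := by
        rw [hsucc, triBdrySucc, if_pos h]
      exact (triLeftApex_ne hadj).1 (e.symm.trans (htail'.trans htail.symm))
    have e' : triBdryIter D.verts D.base (n + m + 1) = (d.1, triLeftApex d.1 d.2) := by
      rw [hsucc, triBdrySucc, if_neg hout]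
    have hdS : (d.1, d.2) ∈ D.stretch a :=
      Finset.mem_image.2 ⟨n + m, Finset.mem_Ico.2 ⟨by omega, by omega⟩, rfl⟩
    have hdS' : (d.1, triLeftApex d.1 d.2) ∈ D.stretch a := by
      rw [← e']
      exact Finset.mem_image.2 ⟨n + m + 1, Finset.mem_Ico.2 ⟨by omega, by omega⟩, rfl⟩
    obtain ⟨i₂, i₃, h₂, h₃, hstep⟩ := classCountK_site_law_stretch h2 hdS hdS' j
    rw [ih (by omega) i₂ h₂, hstep]
    rw [e'] at hi₁ ⊢
    exact classCountK_leftFace_swap hdG (triGraph_adj_triLeftApex_left hadj) h₃ hi₁ j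

end Run

end Literature.Probability.Percolation.MarkedLoops
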